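import Literature.MathematicalPhysics.QuantumFieldTheory.Balaban1983to89.MatrixLog
import Mathlib.Analysis.Matrix.Spectrum

/-!
# UnitaryCayley — BRICK B2a of the requested lattice lemma `torusSmallFieldGlobalGauge` (INTERFACE REQUEST NE7, route #1 of the
# NE7 crux, stub S7 NODE O): the CAYLEY TRANSFORM `cay X = (1 + iX)(1 − iX)⁻¹` of a Hermitian matrix — unitary, `2`-Lipschitz in the
# operator norm, conjugation-equivariant, scalar on scalars — by RESOLVENT IDENTITIES ONLY (no branch of the logarithm, no functional
# calculus beyond `Matrix.IsHermitian.spectral_theorem` for the one bound `‖(1 − iX)⁻¹‖ ≤ 1`)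

Cell `pub-balaban`, rung (B)+1 sub-cell t4, lineage `b2b-balaban-t4-ne7-p1`, generation 26 (CRUX PROVER NE7 #1, ruling e34b3e0c); crux
skeleton `t4/skeletons/NE7-CRUX-R1.md` v1.7.6 §4 «INTERFACE REQUEST NE7: `torusSmallFieldGlobalGauge`» (HOME/INBOX.md ll.6031–6037; brick B1 =
`TorusGaugeComb`, p259900).  HONEST FRAMING (page 1): FIXED FINITE T⁴, rung (B)+1; NE7, NE3 NOT PRINTED in [Balaban1984PropagatorsI]–
[Balaban1989LargeFieldII] and NOT PROVED here; continuum YM on T⁴ ⇐ BetaPertH ∧ nine spine estimates (0/9 proved); BetaPertH ⇐ (D1) ∧ (D4) ∧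
CAP+tail; G-an2-4 gates asym, D1 and NE2/3/4; NOT infinite volume, NOT mass gap, NOT Clay.

WHY (design of bricks B2–B4).  The holonomy-spreading step of the requested lemma needs, for every Polyakov holonomy `W ∈ U(n)`, a DISCRETE
PATH `t ↦ A_t(W)` (`0 ≤ t ≤ M`) from `1` to `W⁻¹` in `U(n)` whose steps are `O(1∕M)`, which is LIPSCHITZ in `W` (operator norm) and
CONJUGATION-EQUIVARIANT.  The geodesic `exp(−(t∕M) log W)` needs a branch of `log` that is Lipschitz on a spectral sector — not in Mathlib.
Instead (brick B2b) we write `W = c·cay(H)` with a unit scalar `c = cay(k)` and the Hermitian generator `H = i(1 − c̄W)(1 + c̄W)⁻¹` and use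
the path `cay(−(t∕M)k)·cay(−(t∕M)H)`; then every estimate is a resolvent identity.  THIS FILE supplies the Cayley transform itself.
WHAT ([folklore] matrix analysis; `M_n(ℂ)` with the L²-operator norm, scope `Matrix.Norms.L2Operator`):
 * §1 `norm_diagonal_le`, `conjDiag V v := V·diag v·V⋆` with `conjDiag_mul`, `conjDiag_one`,
   `conjDiag_inv` (inverse when all `v_j ≠ 0`), `norm_conjDiag_le`.
 * §2 for Hermitian `X`: `one_sub_I_smul_eq_conjDiag` (`1 − iX = V·diag(1 − iλ_j)·V⋆`), **`isUnit_det_one_sub_I_smul`**,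
   **`norm_inv_one_sub_I_smul_le_one`** (`‖(1 − iX)⁻¹‖ ≤ 1`, since `|1 − iλ| ≥ 1`), and the `1 + iX` twins.
 * §3 **`cay`**: `cay_eq` (`cay X = 2(1 − iX)⁻¹ − 1`), `cay_zero`, `cay_mul_cay_neg`∕`cay_neg_mul_cay` (`cay(−X) = cay(X)⁻¹`), `star_cay`
   (`(cay X)⋆ = cay(−X)`), **`cay_mem_unitaryGroup`**, `norm_cay_le_one`, **`norm_cay_sub_cay_le`** (`‖cay X − cay Y‖ ≤ 2‖X − Y‖`),
   **`cay_conj`** (`cay(BXB⁻¹) = B·cay X·B⁻¹` for unitary `B`), `smul_one_isHermitian`, **`cay_smul_one`** (`cay(k·1) = scay k · 1`,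
   `scay k = (1 + ik)∕(1 − ik)`), `norm_scay`, `scay_neg_mul_scay`.
HONEST: elementary; nothing of Bałaban asserted; nothing of NE3∕NE7 discharged; 0 sorry.
-/

set_option autoImplicit false

open scoped BigOperators Matrix Matrix.Norms.L2Operator ComplexConjugate
open NormedSpace Complex Matrix

namespace Summit.QuantumFields.BalabanUV.T4Continuum.UnitaryCayley

noncomputable section

variable {n : Type*} [Fintype n] [DecidableEq n]

/-! ## §1 Unitary conjugates of diagonal matrices -/

/-- The operator norm of a diagonal matrix is bounded by a bound on its entries. [folklore] -/
theorem norm_diagonal_le {v : n → ℂ} {B : ℝ} (hB : 0 ≤ B) (h : ∀ j, ‖v j‖ ≤ B) : ‖(diagonal v : Matrix n n ℂ)‖ ≤ B := by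
  rw [Matrix.l2_opNorm_diagonal]
  exact (pi_norm_le_iff_of_nonneg hB).mpr h

/-- `V · diag v · V⋆`. [folklore] -/
def conjDiag (V : Matrix.unitaryGroup n ℂ) (v : n → ℂ) : Matrix n n ℂ := (V : Matrix n n ℂ) * diagonal v * star (V : Matrix n n ℂ)

/-- `conjDiag V v · conjDiag V w = conjDiag V (v·w)`. [folklore] -/
theorem conjDiag_mul (V : Matrix.unitaryGroup n ℂ) (v w : n → ℂ) : conjDiag V v * conjDiag V w = conjDiag V (v * w) := by
  unfold conjDiag
  rw [mul_assoc ((V : Matrix n n ℂ) * diagonal v), ← mul_assoc (star (V : Matrix n n ℂ)), ← mul_assoc (star (V : Matrix n n ℂ)),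
    Unitary.coe_star_mul_self, one_mul, ← mul_assoc, mul_assoc (V : Matrix n n ℂ), diagonal_mul_diagonal]
  rfl

/-- `conjDiag V 1 = 1`. [folklore] -/
theorem conjDiag_one (V : Matrix.unitaryGroup n ℂ) : conjDiag V (fun _ => 1) = 1 := by
  unfold conjDiag
  rw [show (diagonal fun _ : n => (1 : ℂ)) = 1 from diagonal_one, mul_one, Matrix.mem_unitaryGroup_iff.mp V.2]

/-- `conjDiag` is additive and homogeneous: `a • conjDiag V v + b • conjDiag V w = conjDiag V (a•v + b•w)`. [folklore] -/
theorem conjDiag_lin (V : Matrix.unitaryGroup n ℂ) (a b : ℂ) (v w : n → ℂ) :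
    a • conjDiag V v + b • conjDiag V w = conjDiag V (a • v + b • w) := by
  have e : a • diagonal v + b • diagonal w = diagonal (a • v + b • w) := by
    rw [← diagonal_smul, ← diagonal_smul, diagonal_add]; rfl
  unfold conjDiag
  rw [← e, mul_add, add_mul, Matrix.mul_smul, Matrix.smul_mul, Matrix.mul_smul, Matrix.smul_mul]

/-- The norm of `conjDiag V v` is bounded by a bound on the entries of `v`. [folklore] -/
theorem norm_conjDiag_le (V : Matrix.unitaryGroup n ℂ) {v : n → ℂ} {B : ℝ} (hB : 0 ≤ B) (h : ∀ j, ‖v j‖ ≤ B) :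
    ‖conjDiag V v‖ ≤ B := by
  unfold conjDiag
  -- `‖V A V⋆‖ = ‖A‖` (C⋆-identity; the tree's `T4AdjointCovarianceUnitary.opNorm_conj_unitary`, re-derived to keep the import light)
  rw [CStarRing.norm_mul_mem_unitary _ (Unitary.star_mem V.2), CStarRing.norm_mem_unitary_mul _ V.2]
  exact norm_diagonal_le hB h

/-- If no entry of `v` vanishes, `conjDiag V v` has unit determinant and inverse `conjDiag V v⁻¹`. [folklore] -/
theorem conjDiag_inv (V : Matrix.unitaryGroup n ℂ) {v : n → ℂ} (hv : ∀ j, v j ≠ 0) :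
    IsUnit (conjDiag V v).det ∧ (conjDiag V v)⁻¹ = conjDiag V (fun j => (v j)⁻¹) := by
  have hmul : conjDiag V (fun j => (v j)⁻¹) * conjDiag V v = 1 := by
    rw [conjDiag_mul]
    have e : ((fun j => (v j)⁻¹) * v) = fun _ => (1 : ℂ) := by
      funext j
      simp [hv j]
    rw [e, conjDiag_one]
  exact ⟨Matrix.isUnit_det_of_left_inverse hmul, Matrix.inv_eq_left_inv hmul⟩

/-! ## §2 The resolvent `(1 ∓ iX)⁻¹` of a Hermitian matrix -/

/-- For Hermitian `X = V·diag(λ)·V⋆`: `1 − iX = V·diag(1 − iλ_j)·V⋆`. [folklore] -/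
theorem one_sub_I_smul_eq_conjDiag {X : Matrix n n ℂ} (hX : X.IsHermitian) :
    1 - I • X = conjDiag hX.eigenvectorUnitary (fun j => 1 - I * ((hX.eigenvalues j : ℝ) : ℂ)) := by
  have hsp : X = conjDiag hX.eigenvectorUnitary (fun j => ((hX.eigenvalues j : ℝ) : ℂ)) := by
    have h := hX.spectral_theorem
    rw [Unitary.conjStarAlgAut_apply] at h
    exact h
  have e : (fun j => 1 - I * ((hX.eigenvalues j : ℝ) : ℂ))
      = (1 : ℂ) • (fun _ => (1 : ℂ)) + (-I) • (fun j => ((hX.eigenvalues j : ℝ) : ℂ)) := by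
    funext j
    simp [sub_eq_add_neg]
  rw [e, ← conjDiag_lin, conjDiag_one, one_smul, ← hsp, neg_smul, ← sub_eq_add_neg]

/-- `|1 − iλ| ≥ 1` for real `λ`, in the form `‖(1 − iλ)⁻¹‖ ≤ 1` and `1 − iλ ≠ 0`. [folklore] -/
theorem one_sub_I_mul_real (t : ℝ) : (1 : ℂ) - I * (t : ℂ) ≠ 0 ∧ ‖((1 : ℂ) - I * (t : ℂ))⁻¹‖ ≤ 1 := by
  have hre : ((1 : ℂ) - I * (t : ℂ)).re = 1 := by simp
  have hnorm : 1 ≤ ‖(1 : ℂ) - I * (t : ℂ)‖ := by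
    have h := Complex.abs_re_le_norm ((1 : ℂ) - I * (t : ℂ))
    rw [hre, abs_one] at h
    exact h
  have hne : (1 : ℂ) - I * (t : ℂ) ≠ 0 := by
    intro h
    rw [h, norm_zero] at hnorm
    linarith
  refine ⟨hne, ?_⟩
  rw [norm_inv]
  exact inv_le_one_of_one_le₀ hnorm

/-- **`1 − iX` is invertible for Hermitian `X`.** [folklore] -/
theorem isUnit_det_one_sub_I_smul {X : Matrix n n ℂ} (hX : X.IsHermitian) : IsUnit (1 - I • X).det := by
  rw [one_sub_I_smul_eq_conjDiag hX]
  exact (conjDiag_inv _ fun j => (one_sub_I_mul_real _).1).1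

/-- **`‖(1 − iX)⁻¹‖ ≤ 1` for Hermitian `X`** (`(1 − iX)⁻¹ = V·diag((1 − iλ_j)⁻¹)·V⋆`, `|1 − iλ_j| ≥ 1`). [folklore] -/
theorem norm_inv_one_sub_I_smul_le_one {X : Matrix n n ℂ} (hX : X.IsHermitian) : ‖(1 - I • X)⁻¹‖ ≤ 1 := by
  rw [one_sub_I_smul_eq_conjDiag hX, (conjDiag_inv _ fun j => (one_sub_I_mul_real _).1).2]
  exact norm_conjDiag_le _ zero_le_one fun j => (one_sub_I_mul_real _).2

omit [Fintype n] in
/-- `1 + iX = 1 − i(−X)`. [folklore] -/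
theorem one_add_I_smul_eq (X : Matrix n n ℂ) : 1 + I • X = 1 - I • (-X) := by
  rw [smul_neg, sub_neg_eq_add]

/-- `1 + iX` is invertible for Hermitian `X`. [folklore] -/
theorem isUnit_det_one_add_I_smul {X : Matrix n n ℂ} (hX : X.IsHermitian) : IsUnit (1 + I • X).det := by
  rw [one_add_I_smul_eq]
  exact isUnit_det_one_sub_I_smul hX.neg

/-- `‖(1 + iX)⁻¹‖ ≤ 1` for Hermitian `X`. [folklore] -/
theorem norm_inv_one_add_I_smul_le_one {X : Matrix n n ℂ} (hX : X.IsHermitian) : ‖(1 + I • X)⁻¹‖ ≤ 1 := by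
  rw [one_add_I_smul_eq]
  exact norm_inv_one_sub_I_smul_le_one hX.neg

/-! ## §3 The Cayley transform -/

/-- **THE CAYLEY TRANSFORM** `cay X = (1 + iX)(1 − iX)⁻¹` (nonsingular inverse; meaningful for Hermitian `X`). [folklore] -/
def cay (X : Matrix n n ℂ) : Matrix n n ℂ := (1 + I • X) * (1 - I • X)⁻¹

/-- `cay X = 2·(1 − iX)⁻¹ − 1` for Hermitian `X` (since `1 + iX = 2 − (1 − iX)`). [folklore] -/
theorem cay_eq {X : Matrix n n ℂ} (hX : X.IsHermitian) : cay X = (2 : ℂ) • (1 - I • X)⁻¹ - 1 := by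
  unfold cay
  have e : (1 : Matrix n n ℂ) + I • X = (2 : ℂ) • (1 : Matrix n n ℂ) - (1 - I • X) := by
    rw [two_smul]; abel
  rw [e, sub_mul, Matrix.smul_mul, one_mul, Matrix.mul_nonsing_inv _ (isUnit_det_one_sub_I_smul hX)]

/-- The commuted form: `cay X = (1 − iX)⁻¹(1 + iX)`. [folklore] -/
theorem cay_eq' {X : Matrix n n ℂ} (hX : X.IsHermitian) : cay X = (1 - I • X)⁻¹ * (1 + I • X) := by
  rw [cay_eq hX]
  have e : (1 : Matrix n n ℂ) + I • X = (2 : ℂ) • (1 : Matrix n n ℂ) - (1 - I • X) := by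
    rw [two_smul]; abel
  rw [e, mul_sub, Matrix.mul_smul, mul_one, Matrix.nonsing_inv_mul _ (isUnit_det_one_sub_I_smul hX)]

/-- `cay 0 = 1`. [folklore] -/
theorem cay_zero : cay (0 : Matrix n n ℂ) = 1 := by
  simp [cay]

/-- `cay X · cay (−X) = 1` for Hermitian `X`. [folklore] -/
theorem cay_mul_cay_neg {X : Matrix n n ℂ} (hX : X.IsHermitian) : cay X * cay (-X) = 1 := by
  have h1 := isUnit_det_one_sub_I_smul hX
  have h2 := isUnit_det_one_add_I_smul hX
  have hc : ((1 : Matrix n n ℂ) + I • X) * (1 - I • X) = (1 - I • X) * (1 + I • X) := by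
    generalize I • X = Y
    noncomm_ring
  rw [cay_eq' hX.neg, smul_neg, sub_neg_eq_add, ← sub_eq_add_neg, cay]
  calc (1 + I • X) * (1 - I • X)⁻¹ * ((1 + I • X)⁻¹ * (1 - I • X))
      = (1 + I • X) * (((1 + I • X) * (1 - I • X))⁻¹ * (1 - I • X)) := by
        rw [Matrix.mul_inv_rev, mul_assoc, mul_assoc]
    _ = (1 + I • X) * (((1 - I • X) * (1 + I • X))⁻¹ * (1 - I • X)) := by rw [hc]
    _ = ((1 + I • X) * (1 + I • X)⁻¹) * ((1 - I • X)⁻¹ * (1 - I • X)) := by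
        rw [Matrix.mul_inv_rev, mul_assoc, mul_assoc]
    _ = 1 := by rw [Matrix.mul_nonsing_inv _ h2, Matrix.nonsing_inv_mul _ h1, one_mul]

/-- `cay (−X) · cay X = 1` for Hermitian `X`. [folklore] -/
theorem cay_neg_mul_cay {X : Matrix n n ℂ} (hX : X.IsHermitian) : cay (-X) * cay X = 1 := by
  have h := cay_mul_cay_neg hX.neg
  rwa [neg_neg] at h

/-- `(cay X)⋆ = cay (−X)` for Hermitian `X`. [folklore] -/
theorem star_cay {X : Matrix n n ℂ} (hX : X.IsHermitian) : star (cay X) = cay (-X) := by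
  have hs : star (I • X) = -(I • X) := by
    rw [star_smul, Matrix.star_eq_conjTranspose, hX.eq, Complex.star_def, Complex.conj_I, neg_smul]
  rw [cay_eq' hX.neg, smul_neg, sub_neg_eq_add, ← sub_eq_add_neg]
  rw [cay, star_mul, Matrix.star_eq_conjTranspose ((1 - I • X)⁻¹), Matrix.conjTranspose_nonsing_inv,
    ← Matrix.star_eq_conjTranspose, star_sub, star_add, star_one, hs, sub_neg_eq_add, ← sub_eq_add_neg]

/-- **The Cayley transform of a Hermitian matrix is unitary.** [folklore] -/
theorem cay_mem_unitaryGroup {X : Matrix n n ℂ} (hX : X.IsHermitian) : cay X ∈ Matrix.unitaryGroup n ℂ := by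
  rw [Matrix.mem_unitaryGroup_iff, star_cay hX]
  exact cay_mul_cay_neg hX

/-- `‖cay X‖ ≤ 1` for Hermitian `X`. [folklore] -/
theorem norm_cay_le_one {X : Matrix n n ℂ} (hX : X.IsHermitian) : ‖cay X‖ ≤ 1 := by
  rcases isEmpty_or_nonempty n with hn | hn
  · have : cay X = 0 := Subsingleton.elim _ _
    rw [this, norm_zero]; exact zero_le_one
  · exact le_of_eq (CStarRing.norm_coe_unitary (⟨cay X, cay_mem_unitaryGroup hX⟩ : Matrix.unitaryGroup n ℂ))

/-- `A⁻¹ − B⁻¹ = A⁻¹ (B − A) B⁻¹` for invertible `A`, `B`. [folklore] -/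
theorem inv_sub_inv_eq {A B : Matrix n n ℂ} (hA : IsUnit A.det) (hB : IsUnit B.det) : A⁻¹ - B⁻¹ = A⁻¹ * (B - A) * B⁻¹ := by
  rw [mul_sub, sub_mul, Matrix.nonsing_inv_mul _ hA, one_mul, mul_assoc, Matrix.mul_nonsing_inv _ hB, mul_one]

/-- **The Cayley transform is `2`-Lipschitz on Hermitian matrices**: `‖cay X − cay Y‖ ≤ 2‖X − Y‖`
(`cay X − cay Y = 2(1 − iX)⁻¹·i(X − Y)·(1 − iY)⁻¹` and `‖(1 − iX)⁻¹‖, ‖(1 − iY)⁻¹‖ ≤ 1`). [folklore] -/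
theorem norm_cay_sub_cay_le {X Y : Matrix n n ℂ} (hX : X.IsHermitian) (hY : Y.IsHermitian) : ‖cay X - cay Y‖ ≤ 2 * ‖X - Y‖ := by
  rw [cay_eq hX, cay_eq hY, sub_sub_sub_cancel_right, ← smul_sub,
    inv_sub_inv_eq (isUnit_det_one_sub_I_smul hX) (isUnit_det_one_sub_I_smul hY)]
  have e : ((1 : Matrix n n ℂ) - I • Y) - (1 - I • X) = I • (X - Y) := by rw [smul_sub]; abel
  rw [e, norm_smul, show ‖(2 : ℂ)‖ = 2 by norm_num]
  gcongr
  calc ‖(1 - I • X)⁻¹ * I • (X - Y) * (1 - I • Y)⁻¹‖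
      ≤ ‖(1 - I • X)⁻¹‖ * ‖I • (X - Y)‖ * ‖(1 - I • Y)⁻¹‖ := by
        refine (norm_mul_le _ _).trans ?_
        gcongr
        rw [Matrix.mul_smul]
        rw [norm_smul, norm_smul]
        exact mul_le_mul_of_nonneg_left (norm_mul_le _ _) (norm_nonneg _) |>.trans (le_of_eq (by ring))
    _ ≤ 1 * ‖I • (X - Y)‖ * 1 := by
        gcongr
        · exact norm_inv_one_sub_I_smul_le_one hX
        · exact norm_inv_one_sub_I_smul_le_one hY
    _ = ‖X - Y‖ := by rw [one_mul, mul_one, norm_smul, Complex.norm_I, one_mul]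

/-- The inverse of a unitary matrix is its adjoint, and it has unit determinant. [folklore] -/
theorem inv_eq_star_of_mem {B : Matrix n n ℂ} (hB : B ∈ Matrix.unitaryGroup n ℂ) : IsUnit B.det ∧ B⁻¹ = star B := by
  have h1 : star B * B = 1 := Matrix.mem_unitaryGroup_iff'.mp hB
  exact ⟨Matrix.isUnit_det_of_left_inverse h1, Matrix.inv_eq_left_inv h1⟩

/-- `(B Y B⁻¹)⁻¹ = B Y⁻¹ B⁻¹` for invertible `B`, `Y`. [folklore] -/
theorem conj_inv {B Y : Matrix n n ℂ} (hB : IsUnit B.det) (hY : IsUnit Y.det) : (B * Y * B⁻¹)⁻¹ = B * Y⁻¹ * B⁻¹ := by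
  apply Matrix.inv_eq_left_inv
  rw [mul_assoc (B * Y⁻¹), ← mul_assoc B⁻¹, ← mul_assoc B⁻¹, Matrix.nonsing_inv_mul _ hB, one_mul, mul_assoc B,
    ← mul_assoc Y⁻¹, Matrix.nonsing_inv_mul _ hY, one_mul, Matrix.mul_nonsing_inv _ hB]

/-- A unitary conjugate of a Hermitian matrix is Hermitian. [folklore] -/
theorem isHermitian_conj {B X : Matrix n n ℂ} (hB : B ∈ Matrix.unitaryGroup n ℂ) (hX : X.IsHermitian) : (B * X * B⁻¹).IsHermitian := by
  rw [(inv_eq_star_of_mem hB).2]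
  exact Matrix.isHermitian_mul_mul_conjTranspose _ hX

/-- **Conjugation equivariance**: `cay (B X B⁻¹) = B · cay X · B⁻¹` for unitary `B` and Hermitian `X`. [folklore] -/
theorem cay_conj {B X : Matrix n n ℂ} (hB : B ∈ Matrix.unitaryGroup n ℂ) (hX : X.IsHermitian) : cay (B * X * B⁻¹) = B * cay X * B⁻¹ := by
  have hBd := (inv_eq_star_of_mem hB).1
  have e1 : (1 : Matrix n n ℂ) - I • (B * X * B⁻¹) = B * (1 - I • X) * B⁻¹ := by
    rw [mul_sub, sub_mul, mul_one, Matrix.mul_nonsing_inv _ hBd, Matrix.mul_smul, Matrix.smul_mul]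
  have e2 : (1 : Matrix n n ℂ) + I • (B * X * B⁻¹) = B * (1 + I • X) * B⁻¹ := by
    rw [mul_add, add_mul, mul_one, Matrix.mul_nonsing_inv _ hBd, Matrix.mul_smul, Matrix.smul_mul]
  rw [cay, e1, e2, conj_inv hBd (isUnit_det_one_sub_I_smul hX), cay]
  rw [mul_assoc (B * (1 + I • X)), ← mul_assoc B⁻¹, ← mul_assoc B⁻¹, Matrix.nonsing_inv_mul _ hBd, one_mul, ← mul_assoc,
    mul_assoc B]

/-- The scalar Cayley transform `scay k = (1 + ik)(1 − ik)⁻¹`, a unit complex number for real `k`. [folklore] -/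
def scay (k : ℝ) : ℂ := (1 + I * (k : ℂ)) * (1 - I * (k : ℂ))⁻¹

omit [Fintype n] in
/-- Real scalar matrices are Hermitian. [folklore] -/
theorem smul_one_isHermitian (k : ℝ) : ((k : ℂ) • (1 : Matrix n n ℂ)).IsHermitian := by
  unfold Matrix.IsHermitian
  rw [conjTranspose_smul, conjTranspose_one, Complex.star_def, Complex.conj_ofReal]

omit [Fintype n] [DecidableEq n] in
/-- Real multiples of Hermitian matrices are Hermitian. [folklore] -/
theorem smul_isHermitian (s : ℝ) {X : Matrix n n ℂ} (hX : X.IsHermitian) : ((s : ℂ) • X).IsHermitian := by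
  unfold Matrix.IsHermitian
  rw [conjTranspose_smul, hX.eq, Complex.star_def, Complex.conj_ofReal]

/-- **The Cayley transform of a scalar matrix is the scalar Cayley transform**: `cay (k·1) = scay k · 1`. [folklore] -/
theorem cay_smul_one (k : ℝ) : cay ((k : ℂ) • (1 : Matrix n n ℂ)) = scay k • (1 : Matrix n n ℂ) := by
  have hne := (one_sub_I_mul_real k).1
  have e1 : (1 : Matrix n n ℂ) - I • ((k : ℂ) • (1 : Matrix n n ℂ)) = (1 - I * (k : ℂ)) • (1 : Matrix n n ℂ) := by
    rw [smul_smul, sub_smul, one_smul]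
  have e2 : (1 : Matrix n n ℂ) + I • ((k : ℂ) • (1 : Matrix n n ℂ)) = (1 + I * (k : ℂ)) • (1 : Matrix n n ℂ) := by
    rw [smul_smul, add_smul, one_smul]
  have einv : ((1 - I * (k : ℂ)) • (1 : Matrix n n ℂ))⁻¹ = (1 - I * (k : ℂ))⁻¹ • (1 : Matrix n n ℂ) := by
    apply Matrix.inv_eq_left_inv
    rw [smul_mul_smul_comm, inv_mul_cancel₀ hne, one_mul, one_smul]
  rw [cay, e1, e2, einv, smul_mul_smul_comm, one_mul, scay]

/-- `|scay k| = 1` for real `k`. [folklore] -/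
theorem norm_scay (k : ℝ) : ‖scay k‖ = 1 := by
  have hne := (one_sub_I_mul_real k).1
  have hconj : (1 : ℂ) - I * (k : ℂ) = conj (1 + I * (k : ℂ)) := by
    simp [map_add, map_mul, Complex.conj_I, Complex.conj_ofReal, sub_eq_add_neg]
  have hne' : ‖(1 : ℂ) + I * (k : ℂ)‖ ≠ 0 := by
    rw [← Complex.norm_conj, ← hconj]
    exact norm_ne_zero_iff.mpr hne
  rw [scay, norm_mul, norm_inv, hconj, Complex.norm_conj]
  exact mul_inv_cancel₀ hne'

/-- `scay (−k) · scay k = 1`. [folklore] -/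
theorem scay_neg_mul_scay (k : ℝ) : scay (-k) * scay k = 1 := by
  have h1 := (one_sub_I_mul_real k).1
  have h2 := (one_sub_I_mul_real (-k)).1
  push_cast at h2 ⊢
  unfold scay
  push_cast
  have e : (1 : ℂ) + I * -(k : ℂ) = 1 - I * (k : ℂ) := by ring
  have e' : (1 : ℂ) - I * -(k : ℂ) = 1 + I * (k : ℂ) := by ring
  rw [e, e']
  rw [e'] at h2
  field_simp

/-- `scay` is `2`-Lipschitz: `|scay a − scay b| ≤ 2|a − b|` (the `1 × 1` case of `norm_cay_sub_cay_le`). [folklore] -/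
theorem norm_scay_sub_scay_le (a b : ℝ) : ‖scay a - scay b‖ ≤ 2 * |a - b| := by
  have h := norm_cay_sub_cay_le (smul_one_isHermitian (n := Fin 1) a) (smul_one_isHermitian (n := Fin 1) b)
  rw [cay_smul_one, cay_smul_one, ← sub_smul, ← sub_smul, norm_smul, norm_smul, norm_one, mul_one, mul_one,
    ← Complex.ofReal_sub, Complex.norm_real, Real.norm_eq_abs] at h
  exact h

end

end Summit.QuantumFields.BalabanUV.T4Continuum.UnitaryCayley
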